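import Mathlib
import Literature.Analysis.FluidPDE.Tao2016AveragedNS.ShiftSetCascadeFlows
import Summits.NavierStokesRegularity.NavierStokesRegularity.Theorems.TaoLadderRungTwoFlatCertificateGlueCheckerFieldArrayOn
import Summits.NavierStokesRegularity.NavierStokesRegularity.Theorems.TaoLadderRungTwoFlatCertificateGlueLohnerStepOn
import Summits.NavierStokesRegularity.NavierStokesRegularity.Theorems.TaylorModelRungThreeCertificateIntervalDPoly
import Summits.NavierStokesRegularity.NavierStokesRegularity.Theorems.TaylorModelRungThreeCertificateIntervalDJetsArrayVD
import HarnessLib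

/-!
# Certificate glue on a shift set `𝕊`, XXV: THE CHECKER'S TAYLOR CLAUSES — computable enclosures of the centre Taylor
  polynomial `TPoly` and of the variational polynomial `VPoly` of the window field, and the Boolean tests of the Lohner
  clauses C4 (centre defect `dP`) and C5 (variational bound `NVh`) with their soundness
  (helper for items stmt-NavierStokesRegularity-22987 `FlatGapCertificatesV2` (crux K_A♭ of route TaoLadderRungTwoFlat)
  and stmt-24295 K_A₂(64); cell harvest/h2-tao-ladder, p1 g15; CHECKER-SPEC-v3 §3 (ii) clauses C4/C5)

The Lohner step of glue XIX-c and XIX-e (`stepCert_of_plohner_*`, `LandingClausesAt`) asks, per step, for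
`|TPoly Q p x h − x'| ≤ dP` (C4) and `|VPoly Q p x v h|_c ≤ NVh·N` whenever `|v| ≤ N` (C5), `Q = PQcN …`. With glue XXIV/XXIV-b
(the interval twin `pqBoxA`, jets enclosed by `jetLevelsA`) and pub-ns-dss's `polyLevelsA` (rounded Horner over a table of
levels) / `varJetLevelsA` (variational jets along the state levels):

* `mem_TPoly_polyLevels` — `TPoly Q p x u c ∈ polyLevelsA n prec (jetLevelsA n pqBoxA prec X p) p H` for `x ∈ X`, `u ∈ H`;
* `checkTPoly` / `abs_TPoly_sub_le_of_checkTPoly` — C4 from `mag (poly ⊖ x'_c) ≤ dP` per coordinate;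
* `VPoly_smul`, `mem_VPoly_polyLevels` — `VPoly Q p x v u c` enclosed for `v` in a direction box `D`;
* `unitBoxA`, `checkNVh` / `abs_VPoly_le_of_checkNVh` — C5 from the unit direction box by homogeneity.

All tests are total computable functions on dyadic data (kernel-checkable Booleans); the soundness theorems state
exactly the hypotheses `hdP` / `hNVh` of glue XVIII/XIX-c for the real values of the data.

HONEST FRAMING: Tao-type MODEL lattices (Tao 2016 §4/§6 vocabulary, shift-set parametrised); interval-arithmetic soundness
— no certificate data, nothing certified, no stub closed, nothing about the Navier–Stokes equations.
-/

-- the sub-problem namespace repeats the summit name by design (D-0017)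
set_option linter.dupNamespace false

namespace Summit.NavierStokesRegularity.NavierStokesRegularity.Theorems

open Set Finset Literature.Analysis.FluidPDE Literature.Analysis.FluidPDE.TaoCascade
open Summit.NavierStokesRegularity.NavierStokesRegularity.Theorems.TaylorModelCert
open Summit.NavierStokesRegularity.NavierStokesRegularity.Theorems.TaylorModelReadout

namespace CertificateGlueOn

variable {m : ℕ} {Kb Ka : ℤ} {ω : Fin m → ℤ → ℝ}
  {ε₀ : ℝ} {α : Fin m → Fin m → Fin m → ℤ × ℤ × ℤ → ℝ}
  {shifts : List (ℤ × ℤ × ℤ)} {prec : ℕ} {coefB : Fin m → ℤ → Fin m → Fin m → ℤ × ℤ × ℤ → IntervalD}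

/-! ### C4: the centre Taylor polynomial -/

/-- **`TPoly` IS ENCLOSED** by the Horner values of the materialised jets: for `x` with coordinates in `X` and `u ∈ H`,
`TPoly (PQcN …) p x u c ∈ (polyLevelsA n prec (jetLevelsA n pqBoxA prec X p) p H)[c]`.
[cite: Tao2016AveragedNS, §4 (4.8); cell certificate format, checker clauses] -/
theorem mem_TPoly_polyLevels (hKb : 0 ≤ Kb) (hKa : 1 ≤ Ka) (hnd : shifts.Nodup)
    (hcoef : CoefBoxOK shifts ε₀ α Kb Ka ω coefB) (p : ℕ) {X : Array IntervalD} (hX : X.size = m * winLen Kb Ka)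
    {x : Fin (m * winLen Kb Ka) → ℝ} (hx : ∀ c < m * winLen Kb Ka, IntervalD.mem (rdN x c) (IntervalD.aget X c))
    {H : IntervalD} {u : ℝ} (hu : IntervalD.mem u H) :
    ∀ c < m * winLen Kb Ka, IntervalD.mem (rdN (TPoly (PQcN shifts.toFinset ε₀ α Kb Ka ω) p x u) c)
      (IntervalD.aget (IntervalD.polyLevelsA (m * winLen Kb Ka) prec
        (IntervalD.jetLevelsA (m * winLen Kb Ka) (pqBoxA Kb Ka prec shifts coefB) prec X p) p H) c) := by
  intro c hc
  rw [rdN_of_lt _ hc]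
  have h := IntervalD.mem_polyLevelsA prec
    (a := fun k c => rdN (taylorJet (PQcN shifts.toFinset ε₀ α Kb Ka ω) x k) c)
    (mem_taylorJet_pqLevels (prec := prec) hKb hKa hnd hcoef p hX hx) hu c hc
  simp only [rdN_of_lt _ hc] at h
  exact h

/-- Reader of a dyadic data vector (junk `0` beyond the size). [folklore] -/
def dgetD (v : Array Dyad) (c : ℕ) : Dyad := if h : c < v.size then v[c] else Dyad.ofInt 0

/-- **The C4 test**: per coordinate, `mag (polyBox c ⊖ x'_c) ≤ dP`. [folklore] -/
def checkTPoly (n prec : ℕ) (P : Array IntervalD) (x' : Array Dyad) (dP : Dyad) : Bool :=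
  (List.range n).all fun c =>
    Dyad.ble (IntervalD.mag (IntervalD.subR prec (IntervalD.aget P c) (IntervalD.ofDyad (dgetD x' c)))) dP

/-- Soundness of the C4 test against any enclosure table `P` of the polynomial. [folklore] -/
theorem abs_sub_le_of_checkTPoly {n prec : ℕ} {P : Array IntervalD} {x' : Array Dyad} {dP : Dyad}
    (h : checkTPoly n prec P x' dP = true) {f : Fin n → ℝ} (hf : ∀ c < n, IntervalD.mem (rdN f c) (IntervalD.aget P c)) :
    ∀ c : Fin n, |f c - (dgetD x' c).toReal| ≤ dP.toReal := by
  intro c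
  simp only [checkTPoly, List.all_eq_true, List.mem_range, Dyad.ble_iff] at h
  have h1 := hf c c.isLt
  rw [rdN_of_lt _ c.isLt] at h1
  have h2 := IntervalD.mem_subR prec h1 (IntervalD.mem_ofDyad (dgetD x' c))
  exact (IntervalD.abs_le_mag h2).trans (h c c.isLt)

/-- **C4 FROM THE TEST**: `checkTPoly` on the Horner table of the jets of `x` at `u = h` gives the hypothesis `hdP` of glue
XVIII/XIX-c for `x'_c := (x' c).toReal`, `dP := dP.toReal`. [cite: Tao2016AveragedNS, §4 (4.8); cell certificate format, checker clauses] -/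
theorem abs_TPoly_sub_le_of_checkTPoly (hKb : 0 ≤ Kb) (hKa : 1 ≤ Ka) (hnd : shifts.Nodup)
    (hcoef : CoefBoxOK shifts ε₀ α Kb Ka ω coefB) (p : ℕ) {X : Array IntervalD} (hX : X.size = m * winLen Kb Ka)
    {x : Fin (m * winLen Kb Ka) → ℝ} (hx : ∀ c < m * winLen Kb Ka, IntervalD.mem (rdN x c) (IntervalD.aget X c))
    {H : IntervalD} {u : ℝ} (hu : IntervalD.mem u H) {x' : Array Dyad} {dP : Dyad}
    (h : checkTPoly (m * winLen Kb Ka) prec (IntervalD.polyLevelsA (m * winLen Kb Ka) prec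
      (IntervalD.jetLevelsA (m * winLen Kb Ka) (pqBoxA Kb Ka prec shifts coefB) prec X p) p H) x' dP = true) :
    ∀ c, |TPoly (PQcN shifts.toFinset ε₀ α Kb Ka ω) p x u c - (dgetD x' c).toReal| ≤ dP.toReal :=
  abs_sub_le_of_checkTPoly h (mem_TPoly_polyLevels hKb hKa hnd hcoef p hX hx hu)

/-! ### C5: the variational polynomial -/

/-- `VPoly` is homogeneous in the direction for a bilinear field. [folklore] -/
theorem VPoly_smul {n : ℕ} {Q : (Fin n → ℝ) → (Fin n → ℝ) → Fin n → ℝ} (hQl : ∀ u, IsLinearMap ℝ (Q u))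
    (hQr : ∀ v, IsLinearMap ℝ (fun u => Q u v)) (p : ℕ) (x v : Fin n → ℝ) (r u : ℝ) :
    VPoly Q p x (r • v) u = r • VPoly Q p x v u := by
  have h1 : ∀ (r : ℝ) (a b : Fin n → ℝ), Q a (r • b) = r • Q a b := fun r a b => IsLinearMap.map_smul (hQl a) r b
  have h2 : ∀ (r : ℝ) (a b : Fin n → ℝ), Q (r • a) b = r • Q a b := fun r a b => by
    simpa using IsLinearMap.map_smul (hQr b) r a
  funext c
  simp only [VPoly, Pi.smul_apply, smul_eq_mul, Finset.mul_sum]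
  refine Finset.sum_congr rfl fun k _ => ?_
  rw [varJet_smul (Q := Q) (x := x) h1 h2 r v k, Pi.smul_apply, smul_eq_mul]
  ring

/-- **`VPoly` IS ENCLOSED** along a direction box: for `x ∈ X`, `v ∈ D` (coordinatewise) and `u ∈ H`,
`VPoly (PQcN …) p x v u c ∈ (polyLevelsA n prec (varJetLevelsA n pqBoxA prec (jetLevelsA n pqBoxA prec X p) D p) p H)[c]`.
[cite: Zgliczynski2002C1Lohner, §3–4 (the variational part); cell certificate format, checker clauses] -/
theorem mem_VPoly_polyLevels (hKb : 0 ≤ Kb) (hKa : 1 ≤ Ka) (hnd : shifts.Nodup)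
    (hcoef : CoefBoxOK shifts ε₀ α Kb Ka ω coefB) (p : ℕ) {X D : Array IntervalD} (hX : X.size = m * winLen Kb Ka)
    (hD : D.size = m * winLen Kb Ka) {x v : Fin (m * winLen Kb Ka) → ℝ}
    (hx : ∀ c < m * winLen Kb Ka, IntervalD.mem (rdN x c) (IntervalD.aget X c))
    (hv : ∀ c < m * winLen Kb Ka, IntervalD.mem (rdN v c) (IntervalD.aget D c)) {H : IntervalD} {u : ℝ}
    (hu : IntervalD.mem u H) :
    ∀ c < m * winLen Kb Ka, IntervalD.mem (rdN (VPoly (PQcN shifts.toFinset ε₀ α Kb Ka ω) p x v u) c)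
      (IntervalD.aget (IntervalD.polyLevelsA (m * winLen Kb Ka) prec
        (IntervalD.varJetLevelsA (m * winLen Kb Ka) (pqBoxA Kb Ka prec shifts coefB) prec
          (IntervalD.jetLevelsA (m * winLen Kb Ka) (pqBoxA Kb Ka prec shifts coefB) prec X p) D p) p H) c) := by
  set Q := PQcN shifts.toFinset ε₀ α Kb Ka ω with hQ
  have hjets := IntervalD.mem_varJet_of_varJetLevelsA (rd := rdN (n := m * winLen Kb Ka)) (Q := Q)
    (T := taylorJet Q) (U := varJet Q) (fun _ _ _ => rfl)
    (fun x k c hc => by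
      rw [rdN_of_lt _ hc, taylorJet_succ_apply]
      exact Finset.sum_congr rfl fun i _ => by rw [rdN_of_lt _ hc])
    (fun _ _ _ _ => rfl)
    (fun x v k c hc => by
      rw [rdN_of_lt _ hc, varJet_succ_apply]
      exact Finset.sum_congr rfl fun i _ => by rw [rdN_of_lt _ hc, rdN_of_lt _ hc])
    (isFieldEnclosureA_pqBoxA (prec := prec) hKb hKa hnd hcoef) prec p hX hD hx hv
  intro c hc
  rw [rdN_of_lt _ hc]
  have h := IntervalD.mem_polyLevelsA prec (a := fun k c => rdN (varJet Q x v k) c) hjets hu c hc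
  simp only [rdN_of_lt _ hc] at h
  exact h

/-- The unit direction box `[-1, 1]^n`. [folklore] -/
def unitBoxA (n : ℕ) : Array IntervalD :=
  Array.ofFn fun _ : Fin n => (⟨Dyad.ofInt (-1), Dyad.ofInt 1⟩ : IntervalD)

/-- **The C5 test**: per coordinate, `mag (VB c) ≤ NVh` for the Horner table `VB` of the variational jets on the unit box.
[folklore] -/
def checkNVh (n : ℕ) (VB : Array IntervalD) (NVh : Dyad) : Bool :=
  (List.range n).all fun c => Dyad.ble (IntervalD.mag (IntervalD.aget VB c)) NVh

/-- **C5 FROM THE TEST**: `checkNVh` on the Horner table of the variational jets over the UNIT box at `u = h` gives the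
hypothesis `hNVh` of glue XVIII/XIX-c (`NVh := NVh.toReal`), by homogeneity of `VPoly` in the direction.
[cite: Zgliczynski2002C1Lohner, §3–4 (the variational part); cell certificate format, checker clauses] -/
theorem abs_VPoly_le_of_checkNVh (hKb : 0 ≤ Kb) (hKa : 1 ≤ Ka) (hnd : shifts.Nodup)
    (hcoef : CoefBoxOK shifts ε₀ α Kb Ka ω coefB) (p : ℕ) {X : Array IntervalD} (hX : X.size = m * winLen Kb Ka)
    {x : Fin (m * winLen Kb Ka) → ℝ} (hx : ∀ c < m * winLen Kb Ka, IntervalD.mem (rdN x c) (IntervalD.aget X c))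
    {H : IntervalD} {u : ℝ} (hu : IntervalD.mem u H) {NVh : Dyad}
    (h : checkNVh (m * winLen Kb Ka) (IntervalD.polyLevelsA (m * winLen Kb Ka) prec
      (IntervalD.varJetLevelsA (m * winLen Kb Ka) (pqBoxA Kb Ka prec shifts coefB) prec
        (IntervalD.jetLevelsA (m * winLen Kb Ka) (pqBoxA Kb Ka prec shifts coefB) prec X p)
        (unitBoxA (m * winLen Kb Ka)) p) p H) NVh = true) :
    ∀ (v : Fin (m * winLen Kb Ka) → ℝ) (N : ℝ), 0 ≤ N → (∀ c, |v c| ≤ N) →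
      ∀ c, |VPoly (PQcN shifts.toFinset ε₀ α Kb Ka ω) p x v u c| ≤ NVh.toReal * N := by
  set Q := PQcN shifts.toFinset ε₀ α Kb Ka ω with hQ
  simp only [checkNVh, List.all_eq_true, List.mem_range, Dyad.ble_iff] at h
  -- the bound on the unit box
  have hunit : ∀ w : Fin (m * winLen Kb Ka) → ℝ, (∀ c, |w c| ≤ 1) → ∀ c, |VPoly Q p x w u c| ≤ NVh.toReal := by
    intro w hw c
    have hwD : ∀ c < m * winLen Kb Ka, IntervalD.mem (rdN w c) (IntervalD.aget (unitBoxA (m * winLen Kb Ka)) c) := by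
      intro c hc
      unfold unitBoxA
      rw [IntervalD.aget_ofFn _ hc, rdN_of_lt _ hc]
      have := abs_le.mp (hw ⟨c, hc⟩)
      constructor <;> simp [Dyad.toReal_ofInt, this.1, this.2]
    have hm := mem_VPoly_polyLevels (prec := prec) hKb hKa hnd hcoef p hX (by simp [unitBoxA]) hx hwD hu c c.isLt
    rw [rdN_of_lt _ c.isLt] at hm
    exact (IntervalD.abs_le_mag hm).trans (h c c.isLt)
  intro v N hN hv c
  rcases hN.eq_or_lt with hN0 | hNpos
  · -- `N = 0`: the direction vanishes
    have hv0 : v = 0 := by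
      funext d; have := hv d; rw [← hN0] at this; exact abs_nonpos_iff.mp this
    have : VPoly Q p x v u = 0 := by
      have h0 := VPoly_smul (Q := PQcN shifts.toFinset ε₀ α Kb Ka ω) isLinearMap_PQcN_right isLinearMap_PQcN_left
        p x v 0 u
      rw [zero_smul, zero_smul] at h0
      rw [hv0]; exact h0
    rw [this, ← hN0]; simp
  · have hw : ∀ c, |(N⁻¹ • v) c| ≤ 1 := fun d => by
      rw [Pi.smul_apply, smul_eq_mul, abs_mul, abs_inv, abs_of_pos hNpos]
      exact (inv_mul_le_iff₀ hNpos).mpr (by simpa using hv d)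
    have heq : VPoly Q p x v u = N • VPoly Q p x (N⁻¹ • v) u := by
      rw [← VPoly_smul (Q := PQcN shifts.toFinset ε₀ α Kb Ka ω) isLinearMap_PQcN_right isLinearMap_PQcN_left,
        smul_smul, mul_inv_cancel₀ hNpos.ne', one_smul]
    rw [heq, Pi.smul_apply, smul_eq_mul, abs_mul, abs_of_pos hNpos, mul_comm]
    exact mul_le_mul_of_nonneg_right (hunit _ hw c) hN

end CertificateGlueOn

end Summit.NavierStokesRegularity.NavierStokesRegularity.Theorems
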